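import Mathlib

/-!
# Code lift for gadgets of direct pairs — certificate form (support file)

Item `stmt-MatrixMultiplication-14308` (`FourierTwoFamiliesModP.PrimeTwoFamilies`, CKSU 2005 Conj. 4.7 with
prime cyclic hosts), line `Sketch` (capacity-gadget form), registered stub `codeLift`.

A GADGET is a list `(P σ, Q σ)_{σ<r}` of finite subsets of an abelian group `K`, each pair DIRECT
(`(x - x') + (y - y') = 0 → x = x' ∧ y = y'` inside one pair).  A finite set `W` of words `Fin L → Fin r`
is a ZERO-ERROR CODE for strong separation if for every ordered pair of distinct words `i ≠ k` some
coordinate `t` has every cross difference `q - p` (`p ∈ P (i t)`, `q ∈ Q (k t)`) distinct from every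
diagonal difference `q' - p'` (`p' ∈ P c`, `q' ∈ Q c`, any letter `c`).  `codeLift`: the product blocks
`A w = ∏ₜ P (w t)`, `B w = ∏ₜ Q (w t)` (`w ∈ W`) then satisfy clauses (W) and (X) of the simultaneous
double product property, verbatim as inlined in the route `FourierTwoFamiliesModP`.

Proof organisation (certificate on the finite core).  The relation `(a - a') + (b - b') = 0` between
words `Fin L → K` holds coordinatewise (`coord_eq_zero`), and in ONE coordinate it is equivalent to the
coincidence of the cross difference `b' - a` with the diagonal difference `b - a'` (`core_iff`, the finite
algebraic core of both clauses).  For clause (X) the separating coordinate `t` of the ordered pair `(i, k)`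
supplied by the code hypothesis is the certificate: at `t` that coincidence is forbidden, so `i ≠ k` is
impossible.  Clause (W) is coordinatewise directness.  Mathlib only; no route declaration is imported (the
stub is stated over Mathlib primitives).  The line's lead landed the same statement independently as
`Theorems.PrimeTwoFamilies.CapacityLift.codeLift`; this file keeps its own namespace.
-/

-- single-conjunct summit: the mandated namespace repeats `MatrixMultiplication` (summit = sub-problem).
set_option linter.dupNamespace false

namespace Summit.MatrixMultiplication.MatrixMultiplication.Theorems.PrimeTwoFamilies.CodeLiftK8

/-- The finite core (certificate identity): in an abelian group, `(a - a') + (b - b') = 0` holds iff the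
cross difference `b' - a` coincides with the diagonal difference `b - a'`. -/
private theorem core_iff {K : Type*} [AddCommGroup K] (a a' b b' : K) :
    (a - a') + (b - b') = 0 ↔ b' - a = b - a' := by
  constructor
  · intro h
    have h2 : (b - a') - (b' - a) = (a - a') + (b - b') := by abel
    rw [h, sub_eq_zero] at h2
    exact h2.symm
  · intro h
    have h2 : (a - a') + (b - b') = (b - a') - (b' - a) := by abel
    rw [h2, h, sub_self]

/-- Coordinate projection: a relation `(a - a') + (b - b') = 0` between words `Fin L → K` holds in every
coordinate `t`. -/
private theorem coord_eq_zero {K : Type*} [AddCommGroup K] {L : ℕ} {a a' b b' : Fin L → K}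
    (h : (a - a') + (b - b') = 0) (t : Fin L) : (a t - a' t) + (b t - b' t) = 0 := by
  have := congrFun h t
  simpa using this

/-- **CODE LIFT** (registered stub `codeLift` of crux `PrimeTwoFamilies`, line `Sketch`).  If every letter
`(P c, Q c)` is direct (`hD`) and `W` is a zero-error code for strong separation (`hW`: for words `i ≠ k`
in `W` some coordinate `t` has every cross difference `q - p`, `p ∈ P (i t)`, `q ∈ Q (k t)`, distinct
from every diagonal difference `q' - p'`, `p' ∈ P c`, `q' ∈ Q c`), then the product blocks
`A w = ∏ₜ P (w t)`, `B w = ∏ₜ Q (w t)` (`w ∈ W`) satisfy clause (W) (first conjunct: each block pair is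
direct) and clause (X) (second conjunct: `(a - a') + (b - b') = 0` with `a ∈ A i`, `a' ∈ A j`, `b ∈ B j`,
`b' ∈ B k` forces `i = k`) of the simultaneous double product property. -/
theorem codeLift {K : Type*} [AddCommGroup K] [DecidableEq K] {r L : ℕ}
    (P Q : Fin r → Finset K)
    (hD : ∀ c : Fin r, ∀ x ∈ P c, ∀ x' ∈ P c, ∀ y ∈ Q c, ∀ y' ∈ Q c,
      (x - x') + (y - y') = 0 → x = x' ∧ y = y')
    (W : Finset (Fin L → Fin r))
    (hW : ∀ i ∈ W, ∀ k ∈ W, i ≠ k → ∃ t : Fin L,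
      ∀ p ∈ P (i t), ∀ q ∈ Q (k t), ∀ c : Fin r, ∀ p' ∈ P c, ∀ q' ∈ Q c, q - p ≠ q' - p') :
    (∀ w ∈ W, ∀ a ∈ Fintype.piFinset (fun t => P (w t)), ∀ a' ∈ Fintype.piFinset (fun t => P (w t)),
      ∀ b ∈ Fintype.piFinset (fun t => Q (w t)), ∀ b' ∈ Fintype.piFinset (fun t => Q (w t)),
        (a - a') + (b - b') = 0 → a = a' ∧ b = b') ∧
    (∀ i ∈ W, ∀ j ∈ W, ∀ k ∈ W,
      ∀ a ∈ Fintype.piFinset (fun t => P (i t)), ∀ a' ∈ Fintype.piFinset (fun t => P (j t)),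
      ∀ b ∈ Fintype.piFinset (fun t => Q (j t)), ∀ b' ∈ Fintype.piFinset (fun t => Q (k t)),
        (a - a') + (b - b') = 0 → i = k) := by
  constructor
  · -- (W): every coordinate of the relation is a relation inside the direct letter `w t`
    intro w _ a ha a' ha' b hb b' hb' h
    rw [Fintype.mem_piFinset] at ha ha' hb hb'
    have key : ∀ t, a t = a' t ∧ b t = b' t := fun t =>
      hD (w t) (a t) (ha t) (a' t) (ha' t) (b t) (hb t) (b' t) (hb' t) (coord_eq_zero h t)
    exact ⟨funext fun t => (key t).1, funext fun t => (key t).2⟩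
  · -- (X): the certificate is the separating coordinate `t` of the ordered pair `(i, k)`;
    -- there the core identity turns the relation into a forbidden coincidence of differences
    intro i hi j _ k hk a ha a' ha' b hb b' hb' h
    rw [Fintype.mem_piFinset] at ha ha' hb hb'
    by_contra hik
    obtain ⟨t, ht⟩ := hW i hi k hk hik
    exact ht (a t) (ha t) (b' t) (hb' t) (j t) (a' t) (ha' t) (b t) (hb t)
      ((core_iff (a t) (a' t) (b t) (b' t)).1 (coord_eq_zero h t))

end Summit.MatrixMultiplication.MatrixMultiplication.Theorems.PrimeTwoFamilies.CodeLiftK8
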